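/-
b2b-lace packet, TAIL-BOUND ANALYST gen 11 (unit `b2b-lace-tail-g11`).  (S2b)-IMPR TABLE-SIDE KIT (T8): the sorted-order
node families of [HS92b] Lemma B.4 / [NoBLE17] §5.1 RESTRICTED TO THE THREE CONES of the far cell `Q = {‖x‖₁ ≥ 3}`, for
every `W_d`-invariant sorted-antitone table majorant (`W_{n,j}`, `L_n`, hence `K`, `U`, `T`).  `d`-generic; additive;
no numeral of any dimension; everything proved.
-/
import Literature.Probability.FitznerVanDerHofstad2017.SrwIntegralTUCellSup
import Literature.Probability.FitznerVanDerHofstad2017.SrwIntegralIShiftNearNodes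
import HarnessLib

/-!
# The node families of `W_{n,j}`, `L_n` (and `K`, `U`, `T`) on the three cones of `Q`

CITATION HEADER (PLACEMENT v2). Part of a certified REPRODUCTION of R. Fitzner, R. van der Hofstad,
*Generalized approach to the non-backtracking lace expansion*, Probab. Theory Related Fields **169** (2017)
1041–1119 [NoBLE17] (§5.1 p. 1093: "it suffices to consider the minimal elements of `Q`, namely `3e₁`, `2e₁+e₂`,
`e₁+e₂+e₃`"; (5.9), (5.11) pp. 1091–1092; (5.28)–(5.29) p. 1093) and of T. Hara, G. Slade, *The lace expansion for
self-avoiding walk in five or more dimensions*, Rev. Math. Phys. **4** (1992) 235–327 [HS92b] (App. B, Lemma B.4: the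
sorted-order monotonicity and its node families).  Origin: build `lace` (b2b), the `(S2b)-IMPR` leaf of the `d`-generic
weighted-diagram bound at the TRUE SRW tables, far cell `Q` read CONE BY CONE (`F3BoundsQCones`).

## The point

`SrwIntegralSortedMonotone` §4 proves, for a `W_d`-invariant `F : ℤ^d → ℝ` that is antitone in the SORTED order
(`F (x + z) ≤ F x`, `x, z` sorted non-increasing and `≥ 0`), the finite node families of the symmetric cells:
on `Q = {‖x‖₁ ≥ 3}` the sup of `F` is at most `max (F(3e₁), F(2e₁+e₂), F(2e₁+2e₂), max_{3 ≤ r ≤ d} F(1^r))`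
(`le_of_nodeBounds_three`), and `SrwIntegralTUCellSup` turns this into the cell sups of `U` (through `L_n`, (5.9)),
`K` (through `W_{n,j}`, (5.28)–(5.29)) and `T` (through `K`, (5.11)).

The composite bound on `f₃` ([NoBLE17] (3.87)) is, however, evaluated by the notebooks as the MAXIMUM over the three
minimal shapes of `Q` of the composite AT THAT SHAPE, i.e. cone by cone: every `x ∈ Q` has a `W_d`-image dominating
`v̂ = vecOfParts d v` coordinatewise (`v̂_j ≤ |x_j|`) for one of `v = [3]`, `[2,1]`, `[1,1,1]`
(`F3BoundsQCones.exists_spAct_mem_absCone_of_three_le`).  On the cones of `[2,1]` and `[1,1,1]` the node families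
SHRINK, because a vector dominating `2e₁+e₂` has at least two non-zero coordinates and one dominating `e₁+e₂+e₃` at
least three — the axis node `3e₁` is not below any of them in the sorted order:

* cone of `[3]`     : `3e₁, 2e₁+e₂, 2e₁+2e₂, 1^r (3 ≤ r ≤ d)` (= the whole of `Q`; restated for a uniform API);
* cone of `[2,1]`   : `2e₁+e₂, 2e₁+2e₂, 1^r (3 ≤ r ≤ d)` — the node `3e₁` drops out;
* cone of `[1,1,1]` : `1^r (3 ≤ r ≤ d)` — the nodes `3e₁, 2e₁+e₂, 2e₁+2e₂` drop out;

and, generally, a vector dominating `1^s` is bounded by `max_{s ≤ r ≤ d} F(1^r)` (`le_of_onesBounds_of_dominates`).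
Since the majorants of `T`, `U`, `K` are largest on the axis, the per-cone families are what lets the cones of
`[2,1]` and `[1,1,1]` be read at their own (off-axis) level rather than at the level of `3e₁`.

## Contents (generic `d`; every theorem proved; hypotheses in the raw domination form `∀ j, v̂ j ≤ |x j|`,
which is `x ∈ absCone v̂` of `F3BoundsQCones` by `Iff.rfl`)

§1 abstract `F` (`SpInvariant`, `SortedAntitone`): `le_of_onesBounds_of_dominates`, `le_on_cone_three_of_nodeBounds`,
   `le_on_cone_two_one_of_nodeBounds`, `le_on_cone_one_one_one_of_onesBounds`;
§2 `W_{n,j}` and `L_n` on the three cones; §3 `K_{n,m+j} ≤ √I_{n,2m}(0)·√B` on the three cones (the `W`-split);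
§4 `U_{n,l} ≤ √V'·√B` on the three cones ((5.9)); §5 `T_{n,l}` on the three cones (rules `4/d` and `2/d` of (5.11)).

No dimension, no table, no numeric value; the node VALUES are the business of the certifying table modules.

## References
* [NoBLE17] R. Fitzner, R. van der Hofstad, PTRF 169 (2017) 1041–1119; arXiv:1506.07969 — §5.1 p. 1093, (5.9), (5.11)
  pp. 1091–1092, (5.28)–(5.29) p. 1093; notebook `SRW.nb` §2 (arXiv:1506.07977 anc).
* [HS92b] T. Hara, G. Slade, Rev. Math. Phys. 4 (1992) 235–327, App. B, Lemma B.4.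
-/

namespace Literature.Probability.FitznerVanDerHofstad2017

open Finset Real

variable {d : ℕ}

/-! ### §0  Small facts about the three shapes -/

/-- `vecOfParts d [2,1]` is sorted non-increasing. [folklore] -/
private theorem antitone_vecOfParts_two_one' : Antitone (vecOfParts d [2, 1]) := by
  intro μ ν hμν
  have hμν' : (μ : ℕ) ≤ (ν : ℕ) := hμν
  simp only [vecOfParts_pair_apply]
  split_ifs <;> omega

/-- `vecOfParts d [3]` is sorted non-increasing. [folklore] -/
private theorem antitone_vecOfParts_three' : Antitone (vecOfParts d [3]) := by
  intro μ ν hμν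
  have hμν' : (μ : ℕ) ≤ (ν : ℕ) := hμν
  simp only [vecOfParts_single_apply]
  split_ifs <;> omega

/-- `classVec d s 0 = 1^s` is sorted non-increasing. [folklore] -/
private theorem antitone_classVec_zero (s : ℕ) : Antitone (classVec d s 0) := by
  intro μ ν hμν
  have hμν' : (μ : ℕ) ≤ (ν : ℕ) := hμν
  simp only [classVec_zero_right_apply]
  split_ifs <;> omega

/-- A sorted image that dominates a vector is non-negative when the vector is. [folklore] -/
private theorem nonneg_of_dominates {v y : Fin d → ℤ} (hv : ∀ j, 0 ≤ v j) (hvy : ∀ j, v j ≤ y j) :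
    ∀ j, 0 ≤ y j := fun j => (hv j).trans (hvy j)

/-- If a sorted non-negative `y` is `≥ 1` on the coordinates `< s` (`s ≤ d`), its support size is `≥ s`. [folklore] -/
private theorem le_suppCount_of_one_le (y : Fin d → ℤ) (hy : Antitone y) (hy0 : ∀ i, 0 ≤ y i)
    {s : ℕ} (hsd : s ≤ d) (hs : ∀ μ : Fin d, (μ : ℕ) < s → 1 ≤ y μ) : s ≤ suppCount y := by
  refine Nat.le_of_not_lt fun hlt => ?_
  have hμ : suppCount y < d := lt_of_lt_of_le hlt hsd
  have h0 := (support_initial_of_antitone y hy hy0).2 ⟨suppCount y, hμ⟩ le_rfl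
  have h1 := hs ⟨suppCount y, hμ⟩ hlt
  omega

/-- Domination of `vecOfParts d [3]` forces `‖x‖₁ ≥ 3` (`d ≥ 1`). [folklore] -/
private theorem three_le_sum_abs_of_dominates_three (hd : 1 ≤ d) (x : Fin d → ℤ)
    (hx : ∀ j, vecOfParts d [3] j ≤ |x j|) : 3 ≤ ∑ j, |x j| := by
  have h0 := hx ⟨0, by omega⟩
  rw [vecOfParts_single_apply, if_pos rfl] at h0
  push_cast at h0
  exact h0.trans (Finset.single_le_sum (fun j _ => abs_nonneg (x j)) (Finset.mem_univ _))

/-! ### §1  Abstract `F`: the node families on the cones -/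

/-- **Support family on the cone of `1^s`.**  For `F` `W_d`-invariant and sorted-antitone, `s ≤ d`, and `x` with
`|x_j| ≥ 1` for `j < s` (i.e. `x` dominates `1^s = classVec d s 0`): `F x ≤ max_{s ≤ r ≤ d} F(1^r)` — the sorted
rearrangement of `|x|` has support size `r ≥ s` and is `1^r + z` with `z` sorted non-negative (`s = 0`: the cell
"all `x`", node `1^0 = 0` included).
[cite: HaraSlade1992b, App. B, Lemma B.4] -/
theorem le_of_onesBounds_of_dominates (F : (Fin d → ℤ) → ℝ) (hI : SpInvariant F) (hF : SortedAntitone F)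
    {s : ℕ} (hsd : s ≤ d) (B : ℝ)
    (hB : ∀ r : ℕ, s ≤ r → r ≤ d → F (classVec d r 0) ≤ B)
    (x : Fin d → ℤ) (hx : ∀ j, classVec d s 0 j ≤ |x j|) : F x ≤ B := by
  obtain ⟨τ, hanti, hge, -⟩ := exists_spAct_antitone_ge x (classVec d s 0) (antitone_classVec_zero s) hx
  set y := spAct τ x with hydef
  have hy0 : ∀ j, 0 ≤ y j := nonneg_of_dominates
    (fun j => by simp only [classVec_zero_right_apply]; split_ifs <;> omega) hge
  have hsupp : s ≤ suppCount y := le_suppCount_of_one_le y hanti hy0 hsd fun μ hμ => by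
    have := hge μ
    rw [classVec_zero_right_apply, if_pos hμ] at this
    exact this
  rw [← hI τ x]
  exact (le_classVec_suppCount_of_antitone F hF y hanti hy0).trans (hB _ hsupp (suppCount_le _))

/-- **Cone of `3e₁`** (`d ≥ 1`): the full `Q`-family `3e₁, 2e₁+e₂, 2e₁+2e₂, 1^r (3 ≤ r ≤ d)` — the restriction of
`le_of_nodeBounds_three` to the cone (a vector dominating `3e₁` has `‖x‖₁ ≥ 3`).
[cite: FitznerVanDerHofstad2016NoBLE, §5.1 p. 1093; HaraSlade1992b, App. B, Lemma B.4] -/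
theorem le_on_cone_three_of_nodeBounds (F : (Fin d → ℤ) → ℝ) (hI : SpInvariant F) (hF : SortedAntitone F)
    (hd : 1 ≤ d) (B : ℝ) (h3 : F (vecOfParts d [3]) ≤ B) (h21 : F (vecOfParts d [2, 1]) ≤ B)
    (h22 : F (vecOfParts d [2, 2]) ≤ B) (hB : ∀ r : ℕ, 3 ≤ r → r ≤ d → F (classVec d r 0) ≤ B)
    (x : Fin d → ℤ) (hx : ∀ j, vecOfParts d [3] j ≤ |x j|) : F x ≤ B :=
  le_of_nodeBounds_three F hI hF B h3 h21 h22 hB x (three_le_sum_abs_of_dominates_three hd x hx)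

/-- **Cone of `2e₁+e₂`** (`d ≥ 2`): the family `2e₁+e₂, 2e₁+2e₂, 1^r (3 ≤ r ≤ d)` — NO `3e₁`.  The sorted
rearrangement `y` of `|x|` dominates `(2,1,0,…)`, so it has support size `r ≥ 2` and `Σ y ≥ 3`; if `r ≥ 3` it is
`1^r + z`, if `r = 2` it is `(2,1)+z` or `(2,2)+z` (`le_pair_nodes_of_suppCount_eq_two`).
[cite: FitznerVanDerHofstad2016NoBLE, §5.1 p. 1093; HaraSlade1992b, App. B, Lemma B.4] -/
theorem le_on_cone_two_one_of_nodeBounds (F : (Fin d → ℤ) → ℝ) (hI : SpInvariant F)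
    (hF : SortedAntitone F) (hd : 2 ≤ d) (B : ℝ) (h21 : F (vecOfParts d [2, 1]) ≤ B)
    (h22 : F (vecOfParts d [2, 2]) ≤ B) (hB : ∀ r : ℕ, 3 ≤ r → r ≤ d → F (classVec d r 0) ≤ B)
    (x : Fin d → ℤ) (hx : ∀ j, vecOfParts d [2, 1] j ≤ |x j|) : F x ≤ B := by
  obtain ⟨τ, hanti, hge, -⟩ := exists_spAct_antitone_ge x (vecOfParts d [2, 1]) antitone_vecOfParts_two_one' hx
  set y := spAct τ x with hydef
  have hy0 : ∀ j, 0 ≤ y j := nonneg_of_dominates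
    (fun j => by simp only [vecOfParts_pair_apply]; split_ifs <;> omega) hge
  have hge0 := hge ⟨0, by omega⟩
  have hge1 := hge ⟨1, by omega⟩
  rw [vecOfParts_pair_apply] at hge0 hge1
  simp only [if_true, one_ne_zero, if_false] at hge0 hge1
  push_cast at hge0 hge1
  have hsupp : 2 ≤ suppCount y := le_suppCount_of_one_le y hanti hy0 hd fun μ hμ => by
    rcases Nat.lt_succ_iff_lt_or_eq.mp hμ with h | h
    · have : μ = ⟨0, by omega⟩ := Fin.ext (by simpa using h)
      rw [this]; omega
    · have : μ = ⟨1, by omega⟩ := Fin.ext h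
      rw [this]; exact hge1
  have hsum : 3 ≤ ∑ j, y j := by
    have h01 : y ⟨0, by omega⟩ + y ⟨1, by omega⟩ ≤ ∑ j, y j := by
      rw [← Finset.sum_pair (show (⟨0, by omega⟩ : Fin d) ≠ ⟨1, by omega⟩ from
        fun h => absurd (congrArg Fin.val h) (by norm_num))]
      exact Finset.sum_le_sum_of_subset_of_nonneg (Finset.subset_univ _) fun j _ _ => hy0 j
    omega
  rw [← hI τ x]
  rcases Nat.lt_or_ge 2 (suppCount y) with hr3 | hr2
  · exact (le_classVec_suppCount_of_antitone F hF y hanti hy0).trans (hB _ hr3 (suppCount_le _))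
  · have h2 : suppCount y = 2 := le_antisymm hr2 hsupp
    exact (le_pair_nodes_of_suppCount_eq_two F hF y hanti hy0 h2 hsum).trans (max_le h21 h22)

/-- **Cone of `e₁+e₂+e₃`** (`d ≥ 3`): the family `1^r (3 ≤ r ≤ d)` only — NO `3e₁`, `2e₁+e₂`, `2e₁+2e₂`
(a vector dominating `e₁+e₂+e₃` has support size `≥ 3`).
[cite: FitznerVanDerHofstad2016NoBLE, §5.1 p. 1093; HaraSlade1992b, App. B, Lemma B.4] -/
theorem le_on_cone_one_one_one_of_onesBounds (F : (Fin d → ℤ) → ℝ) (hI : SpInvariant F)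
    (hF : SortedAntitone F) (hd : 3 ≤ d) (B : ℝ)
    (hB : ∀ r : ℕ, 3 ≤ r → r ≤ d → F (classVec d r 0) ≤ B)
    (x : Fin d → ℤ) (hx : ∀ j, vecOfParts d [1, 1, 1] j ≤ |x j|) : F x ≤ B :=
  le_of_onesBounds_of_dominates F hI hF hd B hB x fun j => by
    rw [classVec_three_zero_eq_vecOfParts]; exact hx j

/-! ### §2  `W_{n,j}` and `L_n` on the three cones -/

/-- `W_{n,j}` on the cone of `3e₁`: `≤ max (W(3e₁), W(2e₁+e₂), W(2e₁+2e₂), max_{3 ≤ r ≤ d} W(1^r))` (`n ≥ 1`, `d ≥ 2n+1`).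
[cite: FitznerVanDerHofstad2016NoBLE, §5.1 p. 1093] -/
theorem srwW_le_on_cone_three {n : ℕ} (hn : 1 ≤ n) (hd : 2 * n + 1 ≤ d) (j : ℕ) (B : ℝ)
    (h3 : srwW d n j (vecOfParts d [3]) ≤ B) (h21 : srwW d n j (vecOfParts d [2, 1]) ≤ B)
    (h22 : srwW d n j (vecOfParts d [2, 2]) ≤ B)
    (hB : ∀ r : ℕ, 3 ≤ r → r ≤ d → srwW d n j (classVec d r 0) ≤ B)
    (x : Fin d → ℤ) (hx : ∀ i, vecOfParts d [3] i ≤ |x i|) : srwW d n j x ≤ B :=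
  le_on_cone_three_of_nodeBounds _ (spInvariant_srwW n j) (sortedAntitone_srwW hn hd j) (by omega) B h3 h21
    h22 hB x hx

/-- `W_{n,j}` on the cone of `2e₁+e₂`: `≤ max (W(2e₁+e₂), W(2e₁+2e₂), max_{3 ≤ r ≤ d} W(1^r))` (`n ≥ 1`, `d ≥ 2n+1`).
[cite: FitznerVanDerHofstad2016NoBLE, §5.1 p. 1093; HaraSlade1992b, App. B, Lemma B.4] -/
theorem srwW_le_on_cone_two_one {n : ℕ} (hn : 1 ≤ n) (hd : 2 * n + 1 ≤ d) (j : ℕ) (B : ℝ)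
    (h21 : srwW d n j (vecOfParts d [2, 1]) ≤ B) (h22 : srwW d n j (vecOfParts d [2, 2]) ≤ B)
    (hB : ∀ r : ℕ, 3 ≤ r → r ≤ d → srwW d n j (classVec d r 0) ≤ B)
    (x : Fin d → ℤ) (hx : ∀ i, vecOfParts d [2, 1] i ≤ |x i|) : srwW d n j x ≤ B :=
  le_on_cone_two_one_of_nodeBounds _ (spInvariant_srwW n j) (sortedAntitone_srwW hn hd j) (by omega) B h21
    h22 hB x hx

/-- `W_{n,j}` on the cone of `e₁+e₂+e₃`: `≤ max_{3 ≤ r ≤ d} W(1^r)` (`n ≥ 1`, `2n+1 ≤ d`, `d ≥ 3`).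
[cite: FitznerVanDerHofstad2016NoBLE, §5.1 p. 1093; HaraSlade1992b, App. B, Lemma B.4] -/
theorem srwW_le_on_cone_one_one_one {n : ℕ} (hn : 1 ≤ n) (hd : 2 * n + 1 ≤ d) (hd3 : 3 ≤ d) (j : ℕ)
    (B : ℝ) (hB : ∀ r : ℕ, 3 ≤ r → r ≤ d → srwW d n j (classVec d r 0) ≤ B)
    (x : Fin d → ℤ) (hx : ∀ i, vecOfParts d [1, 1, 1] i ≤ |x i|) : srwW d n j x ≤ B :=
  le_on_cone_one_one_one_of_onesBounds _ (spInvariant_srwW n j) (sortedAntitone_srwW hn hd j) hd3 B hB x hx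

/-- `L_n` on the cone of `3e₁` (`n ≥ 1`, `d ≥ 2n+1`). [cite: FitznerVanDerHofstad2016NoBLE, §5.1 p. 1093] -/
theorem srwL_le_on_cone_three {n : ℕ} (hn : 1 ≤ n) (hd : 2 * n + 1 ≤ d) (B : ℝ)
    (h3 : srwL d n (vecOfParts d [3]) ≤ B) (h21 : srwL d n (vecOfParts d [2, 1]) ≤ B)
    (h22 : srwL d n (vecOfParts d [2, 2]) ≤ B)
    (hB : ∀ r : ℕ, 3 ≤ r → r ≤ d → srwL d n (classVec d r 0) ≤ B)
    (x : Fin d → ℤ) (hx : ∀ i, vecOfParts d [3] i ≤ |x i|) : srwL d n x ≤ B :=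
  le_on_cone_three_of_nodeBounds _ (spInvariant_srwL n) (sortedAntitone_srwL hn hd) (by omega) B h3 h21 h22 hB
    x hx

/-- `L_n` on the cone of `2e₁+e₂`: `≤ max (L(2e₁+e₂), L(2e₁+2e₂), max_{3 ≤ r ≤ d} L(1^r))` (`n ≥ 1`, `d ≥ 2n+1`).
[cite: FitznerVanDerHofstad2016NoBLE, §5.1 p. 1093; HaraSlade1992b, App. B, Lemma B.4] -/
theorem srwL_le_on_cone_two_one {n : ℕ} (hn : 1 ≤ n) (hd : 2 * n + 1 ≤ d) (B : ℝ)
    (h21 : srwL d n (vecOfParts d [2, 1]) ≤ B) (h22 : srwL d n (vecOfParts d [2, 2]) ≤ B)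
    (hB : ∀ r : ℕ, 3 ≤ r → r ≤ d → srwL d n (classVec d r 0) ≤ B)
    (x : Fin d → ℤ) (hx : ∀ i, vecOfParts d [2, 1] i ≤ |x i|) : srwL d n x ≤ B :=
  le_on_cone_two_one_of_nodeBounds _ (spInvariant_srwL n) (sortedAntitone_srwL hn hd) (by omega) B h21 h22 hB
    x hx

/-- `L_n` on the cone of `e₁+e₂+e₃`: `≤ max_{3 ≤ r ≤ d} L(1^r)` (`n ≥ 1`, `2n+1 ≤ d`, `d ≥ 3`).
[cite: FitznerVanDerHofstad2016NoBLE, §5.1 p. 1093; HaraSlade1992b, App. B, Lemma B.4] -/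
theorem srwL_le_on_cone_one_one_one {n : ℕ} (hn : 1 ≤ n) (hd : 2 * n + 1 ≤ d) (hd3 : 3 ≤ d) (B : ℝ)
    (hB : ∀ r : ℕ, 3 ≤ r → r ≤ d → srwL d n (classVec d r 0) ≤ B)
    (x : Fin d → ℤ) (hx : ∀ i, vecOfParts d [1, 1, 1] i ≤ |x i|) : srwL d n x ≤ B :=
  le_on_cone_one_one_one_of_onesBounds _ (spInvariant_srwL n) (sortedAntitone_srwL hn hd) hd3 B hB x hx

/-! ### §3  `K_{n,m+j} ≤ √I_{n,2m}(0) · √B` on the three cones (the `W`-split (5.28)–(5.29)) -/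

/-- `K` on the cone of `3e₁`. [cite: FitznerVanDerHofstad2016NoBLE, (5.28)–(5.29) p. 1093, §5.1 p. 1093] -/
theorem srwK_le_on_cone_three {n : ℕ} (hn : 1 ≤ n) (hd : 2 * n + 1 ≤ d) (m j : ℕ) (B : ℝ)
    (h3 : srwW d n j (vecOfParts d [3]) ≤ B) (h21 : srwW d n j (vecOfParts d [2, 1]) ≤ B)
    (h22 : srwW d n j (vecOfParts d [2, 2]) ≤ B)
    (hB : ∀ r : ℕ, 3 ≤ r → r ≤ d → srwW d n j (classVec d r 0) ≤ B)
    (x : Fin d → ℤ) (hx : ∀ i, vecOfParts d [3] i ≤ |x i|) :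
    srwK d n (m + j) x ≤ Real.sqrt (srwI d n (2 * m) 0) * Real.sqrt B :=
  srwK_le_sqrt_of_srwW_le hd m j x (srwW_le_on_cone_three hn hd j B h3 h21 h22 hB x hx)

/-- `K` on the cone of `2e₁+e₂` — nodes `2e₁+e₂, 2e₁+2e₂, 1^r (3 ≤ r ≤ d)` of `W_{n,j}`, no `3e₁`.
[cite: FitznerVanDerHofstad2016NoBLE, (5.28)–(5.29) p. 1093, §5.1 p. 1093] -/
theorem srwK_le_on_cone_two_one {n : ℕ} (hn : 1 ≤ n) (hd : 2 * n + 1 ≤ d) (m j : ℕ) (B : ℝ)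
    (h21 : srwW d n j (vecOfParts d [2, 1]) ≤ B) (h22 : srwW d n j (vecOfParts d [2, 2]) ≤ B)
    (hB : ∀ r : ℕ, 3 ≤ r → r ≤ d → srwW d n j (classVec d r 0) ≤ B)
    (x : Fin d → ℤ) (hx : ∀ i, vecOfParts d [2, 1] i ≤ |x i|) :
    srwK d n (m + j) x ≤ Real.sqrt (srwI d n (2 * m) 0) * Real.sqrt B :=
  srwK_le_sqrt_of_srwW_le hd m j x (srwW_le_on_cone_two_one hn hd j B h21 h22 hB x hx)

/-- `K` on the cone of `e₁+e₂+e₃` — nodes `1^r (3 ≤ r ≤ d)` of `W_{n,j}` only.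
[cite: FitznerVanDerHofstad2016NoBLE, (5.28)–(5.29) p. 1093, §5.1 p. 1093] -/
theorem srwK_le_on_cone_one_one_one {n : ℕ} (hn : 1 ≤ n) (hd : 2 * n + 1 ≤ d) (hd3 : 3 ≤ d) (m j : ℕ)
    (B : ℝ) (hB : ∀ r : ℕ, 3 ≤ r → r ≤ d → srwW d n j (classVec d r 0) ≤ B)
    (x : Fin d → ℤ) (hx : ∀ i, vecOfParts d [1, 1, 1] i ≤ |x i|) :
    srwK d n (m + j) x ≤ Real.sqrt (srwI d n (2 * m) 0) * Real.sqrt B :=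
  srwK_le_sqrt_of_srwW_le hd m j x (srwW_le_on_cone_one_one_one hn hd hd3 j B hB x hx)

/-! ### §4  `U_{n,l} ≤ √V' · √B` on the three cones ((5.9) through `L_n`) -/

/-- `U` on the cone of `3e₁`. [cite: FitznerVanDerHofstad2016NoBLE, (5.9) p. 1091, §5.1 p. 1093] -/
theorem srwU_le_on_cone_three {n : ℕ} (hn : 1 ≤ n) (hd : 2 * n + 1 ≤ d) (l : ℕ) {V' B : ℝ}
    (hV : srwV d n (2 * l) ≤ V') (h3 : srwL d n (vecOfParts d [3]) ≤ B)
    (h21 : srwL d n (vecOfParts d [2, 1]) ≤ B) (h22 : srwL d n (vecOfParts d [2, 2]) ≤ B)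
    (hB : ∀ r : ℕ, 3 ≤ r → r ≤ d → srwL d n (classVec d r 0) ≤ B)
    (x : Fin d → ℤ) (hx : ∀ i, vecOfParts d [3] i ≤ |x i|) : srwU d n l x ≤ Real.sqrt V' * Real.sqrt B :=
  srwU_le_sqrt_of_le hd l x hV (srwL_le_on_cone_three hn hd B h3 h21 h22 hB x hx)

/-- `U` on the cone of `2e₁+e₂` — nodes `2e₁+e₂, 2e₁+2e₂, 1^r (3 ≤ r ≤ d)` of `L_n`, no `3e₁`.
[cite: FitznerVanDerHofstad2016NoBLE, (5.9) p. 1091, §5.1 p. 1093] -/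
theorem srwU_le_on_cone_two_one {n : ℕ} (hn : 1 ≤ n) (hd : 2 * n + 1 ≤ d) (l : ℕ) {V' B : ℝ}
    (hV : srwV d n (2 * l) ≤ V') (h21 : srwL d n (vecOfParts d [2, 1]) ≤ B)
    (h22 : srwL d n (vecOfParts d [2, 2]) ≤ B)
    (hB : ∀ r : ℕ, 3 ≤ r → r ≤ d → srwL d n (classVec d r 0) ≤ B)
    (x : Fin d → ℤ) (hx : ∀ i, vecOfParts d [2, 1] i ≤ |x i|) : srwU d n l x ≤ Real.sqrt V' * Real.sqrt B :=
  srwU_le_sqrt_of_le hd l x hV (srwL_le_on_cone_two_one hn hd B h21 h22 hB x hx)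

/-- `U` on the cone of `e₁+e₂+e₃` — nodes `1^r (3 ≤ r ≤ d)` of `L_n` only.
[cite: FitznerVanDerHofstad2016NoBLE, (5.9) p. 1091, §5.1 p. 1093] -/
theorem srwU_le_on_cone_one_one_one {n : ℕ} (hn : 1 ≤ n) (hd : 2 * n + 1 ≤ d) (hd3 : 3 ≤ d) (l : ℕ)
    {V' B : ℝ} (hV : srwV d n (2 * l) ≤ V')
    (hB : ∀ r : ℕ, 3 ≤ r → r ≤ d → srwL d n (classVec d r 0) ≤ B)
    (x : Fin d → ℤ) (hx : ∀ i, vecOfParts d [1, 1, 1] i ≤ |x i|) : srwU d n l x ≤ Real.sqrt V' * Real.sqrt B :=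
  srwU_le_sqrt_of_le hd l x hV (srwL_le_on_cone_one_one_one hn hd hd3 B hB x hx)

/-! ### §5  `T_{n,l}` on the three cones ((5.11) through `K`) -/

/-- `T` on the cone of `3e₁`, rule `4/d`: splits `l + 1 = m₁ + j₁`, `l = m₀ + j₀`, the `Q`-family of `W_{n,j₁}`, `W_{n,j₀}`.
[cite: FitznerVanDerHofstad2016NoBLE, (5.11) p. 1092, §5.1 p. 1093] -/
theorem srwT_le_on_cone_three_four {n : ℕ} (hn : 1 ≤ n) (hd : 2 * n + 1 ≤ d) {l m₁ j₁ m₀ j₀ : ℕ}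
    (hl1 : m₁ + j₁ = l + 1) (hl0 : m₀ + j₀ = l) (B₁ B₀ : ℝ)
    (h3₁ : srwW d n j₁ (vecOfParts d [3]) ≤ B₁) (h21₁ : srwW d n j₁ (vecOfParts d [2, 1]) ≤ B₁)
    (h22₁ : srwW d n j₁ (vecOfParts d [2, 2]) ≤ B₁)
    (hB1 : ∀ r : ℕ, 3 ≤ r → r ≤ d → srwW d n j₁ (classVec d r 0) ≤ B₁)
    (h3₀ : srwW d n j₀ (vecOfParts d [3]) ≤ B₀) (h21₀ : srwW d n j₀ (vecOfParts d [2, 1]) ≤ B₀)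
    (h22₀ : srwW d n j₀ (vecOfParts d [2, 2]) ≤ B₀)
    (hB0 : ∀ r : ℕ, 3 ≤ r → r ≤ d → srwW d n j₀ (classVec d r 0) ≤ B₀)
    (x : Fin d → ℤ) (hx : ∀ i, vecOfParts d [3] i ≤ |x i|) :
    srwT d n l x ≤ Real.sqrt (srwI d n (2 * m₁) 0) * Real.sqrt B₁ +
      4 / d * (Real.sqrt (srwI d n (2 * m₀) 0) * Real.sqrt B₀) := by
  have h1 := srwK_le_on_cone_three hn hd m₁ j₁ B₁ h3₁ h21₁ h22₁ hB1 x hx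
  have h0 := srwK_le_on_cone_three hn hd m₀ j₀ B₀ h3₀ h21₀ h22₀ hB0 x hx
  rw [hl1] at h1
  rw [hl0] at h0
  exact srwT_le_of_srwK_le_four hd l x h1 h0

/-- `T` on the cone of `2e₁+e₂`, rule `4/d`: the families `2e₁+e₂, 2e₁+2e₂, 1^r (3 ≤ r ≤ d)` of `W_{n,j₁}`, `W_{n,j₀}`.
[cite: FitznerVanDerHofstad2016NoBLE, (5.11) p. 1092, §5.1 p. 1093] -/
theorem srwT_le_on_cone_two_one_four {n : ℕ} (hn : 1 ≤ n) (hd : 2 * n + 1 ≤ d) {l m₁ j₁ m₀ j₀ : ℕ}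
    (hl1 : m₁ + j₁ = l + 1) (hl0 : m₀ + j₀ = l) (B₁ B₀ : ℝ)
    (h21₁ : srwW d n j₁ (vecOfParts d [2, 1]) ≤ B₁) (h22₁ : srwW d n j₁ (vecOfParts d [2, 2]) ≤ B₁)
    (hB1 : ∀ r : ℕ, 3 ≤ r → r ≤ d → srwW d n j₁ (classVec d r 0) ≤ B₁)
    (h21₀ : srwW d n j₀ (vecOfParts d [2, 1]) ≤ B₀) (h22₀ : srwW d n j₀ (vecOfParts d [2, 2]) ≤ B₀)
    (hB0 : ∀ r : ℕ, 3 ≤ r → r ≤ d → srwW d n j₀ (classVec d r 0) ≤ B₀)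
    (x : Fin d → ℤ) (hx : ∀ i, vecOfParts d [2, 1] i ≤ |x i|) :
    srwT d n l x ≤ Real.sqrt (srwI d n (2 * m₁) 0) * Real.sqrt B₁ +
      4 / d * (Real.sqrt (srwI d n (2 * m₀) 0) * Real.sqrt B₀) := by
  have h1 := srwK_le_on_cone_two_one hn hd m₁ j₁ B₁ h21₁ h22₁ hB1 x hx
  have h0 := srwK_le_on_cone_two_one hn hd m₀ j₀ B₀ h21₀ h22₀ hB0 x hx
  rw [hl1] at h1
  rw [hl0] at h0
  exact srwT_le_of_srwK_le_four hd l x h1 h0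

/-- `T` on the cone of `e₁+e₂+e₃`, rule `4/d`: the families `1^r (3 ≤ r ≤ d)` of `W_{n,j₁}`, `W_{n,j₀}` only.
[cite: FitznerVanDerHofstad2016NoBLE, (5.11) p. 1092, §5.1 p. 1093] -/
theorem srwT_le_on_cone_one_one_one_four {n : ℕ} (hn : 1 ≤ n) (hd : 2 * n + 1 ≤ d) (hd3 : 3 ≤ d)
    {l m₁ j₁ m₀ j₀ : ℕ} (hl1 : m₁ + j₁ = l + 1) (hl0 : m₀ + j₀ = l) (B₁ B₀ : ℝ)
    (hB1 : ∀ r : ℕ, 3 ≤ r → r ≤ d → srwW d n j₁ (classVec d r 0) ≤ B₁)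
    (hB0 : ∀ r : ℕ, 3 ≤ r → r ≤ d → srwW d n j₀ (classVec d r 0) ≤ B₀)
    (x : Fin d → ℤ) (hx : ∀ i, vecOfParts d [1, 1, 1] i ≤ |x i|) :
    srwT d n l x ≤ Real.sqrt (srwI d n (2 * m₁) 0) * Real.sqrt B₁ +
      4 / d * (Real.sqrt (srwI d n (2 * m₀) 0) * Real.sqrt B₀) := by
  have h1 := srwK_le_on_cone_one_one_one hn hd hd3 m₁ j₁ B₁ hB1 x hx
  have h0 := srwK_le_on_cone_one_one_one hn hd hd3 m₀ j₀ B₀ hB0 x hx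
  rw [hl1] at h1
  rw [hl0] at h0
  exact srwT_le_of_srwK_le_four hd l x h1 h0

/-- `T` on the cone of `3e₁`, rule `2/d`: `W_{n,j₁}` (`l + 1 = m₁ + j₁`) and `W_{n+1,j₀}` (`l = m₀ + j₀`), `d ≥ 2(n+1)+1`.
[cite: FitznerVanDerHofstad2016NoBLE, (5.11) p. 1092, §5.1 p. 1093] -/
theorem srwT_le_on_cone_three_two {n : ℕ} (hn : 1 ≤ n) (hd : 2 * (n + 1) + 1 ≤ d) {l m₁ j₁ m₀ j₀ : ℕ}
    (hl1 : m₁ + j₁ = l + 1) (hl0 : m₀ + j₀ = l) (B₁ B₀ : ℝ)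
    (h3₁ : srwW d n j₁ (vecOfParts d [3]) ≤ B₁) (h21₁ : srwW d n j₁ (vecOfParts d [2, 1]) ≤ B₁)
    (h22₁ : srwW d n j₁ (vecOfParts d [2, 2]) ≤ B₁)
    (hB1 : ∀ r : ℕ, 3 ≤ r → r ≤ d → srwW d n j₁ (classVec d r 0) ≤ B₁)
    (h3₀ : srwW d (n + 1) j₀ (vecOfParts d [3]) ≤ B₀) (h21₀ : srwW d (n + 1) j₀ (vecOfParts d [2, 1]) ≤ B₀)
    (h22₀ : srwW d (n + 1) j₀ (vecOfParts d [2, 2]) ≤ B₀)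
    (hB0 : ∀ r : ℕ, 3 ≤ r → r ≤ d → srwW d (n + 1) j₀ (classVec d r 0) ≤ B₀)
    (x : Fin d → ℤ) (hx : ∀ i, vecOfParts d [3] i ≤ |x i|) :
    srwT d n l x ≤ Real.sqrt (srwI d n (2 * m₁) 0) * Real.sqrt B₁ +
      2 / d * (Real.sqrt (srwI d (n + 1) (2 * m₀) 0) * Real.sqrt B₀) := by
  have h1 := srwK_le_on_cone_three hn (by omega) m₁ j₁ B₁ h3₁ h21₁ h22₁ hB1 x hx
  have h0 := srwK_le_on_cone_three (by omega) hd m₀ j₀ B₀ h3₀ h21₀ h22₀ hB0 x hx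
  rw [hl1] at h1
  rw [hl0] at h0
  exact srwT_le_of_srwK_le_two hd l x h1 h0

/-- `T` on the cone of `2e₁+e₂`, rule `2/d` (`d ≥ 2(n+1)+1`): no `3e₁` in either family.
[cite: FitznerVanDerHofstad2016NoBLE, (5.11) p. 1092, §5.1 p. 1093] -/
theorem srwT_le_on_cone_two_one_two {n : ℕ} (hn : 1 ≤ n) (hd : 2 * (n + 1) + 1 ≤ d) {l m₁ j₁ m₀ j₀ : ℕ}
    (hl1 : m₁ + j₁ = l + 1) (hl0 : m₀ + j₀ = l) (B₁ B₀ : ℝ)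
    (h21₁ : srwW d n j₁ (vecOfParts d [2, 1]) ≤ B₁) (h22₁ : srwW d n j₁ (vecOfParts d [2, 2]) ≤ B₁)
    (hB1 : ∀ r : ℕ, 3 ≤ r → r ≤ d → srwW d n j₁ (classVec d r 0) ≤ B₁)
    (h21₀ : srwW d (n + 1) j₀ (vecOfParts d [2, 1]) ≤ B₀) (h22₀ : srwW d (n + 1) j₀ (vecOfParts d [2, 2]) ≤ B₀)
    (hB0 : ∀ r : ℕ, 3 ≤ r → r ≤ d → srwW d (n + 1) j₀ (classVec d r 0) ≤ B₀)
    (x : Fin d → ℤ) (hx : ∀ i, vecOfParts d [2, 1] i ≤ |x i|) :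
    srwT d n l x ≤ Real.sqrt (srwI d n (2 * m₁) 0) * Real.sqrt B₁ +
      2 / d * (Real.sqrt (srwI d (n + 1) (2 * m₀) 0) * Real.sqrt B₀) := by
  have h1 := srwK_le_on_cone_two_one hn (by omega) m₁ j₁ B₁ h21₁ h22₁ hB1 x hx
  have h0 := srwK_le_on_cone_two_one (by omega) hd m₀ j₀ B₀ h21₀ h22₀ hB0 x hx
  rw [hl1] at h1
  rw [hl0] at h0
  exact srwT_le_of_srwK_le_two hd l x h1 h0

/-- `T` on the cone of `e₁+e₂+e₃`, rule `2/d` (`d ≥ 2(n+1)+1`, `d ≥ 3`): the families `1^r (3 ≤ r ≤ d)` only.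
[cite: FitznerVanDerHofstad2016NoBLE, (5.11) p. 1092, §5.1 p. 1093] -/
theorem srwT_le_on_cone_one_one_one_two {n : ℕ} (hn : 1 ≤ n) (hd : 2 * (n + 1) + 1 ≤ d) (hd3 : 3 ≤ d)
    {l m₁ j₁ m₀ j₀ : ℕ} (hl1 : m₁ + j₁ = l + 1) (hl0 : m₀ + j₀ = l) (B₁ B₀ : ℝ)
    (hB1 : ∀ r : ℕ, 3 ≤ r → r ≤ d → srwW d n j₁ (classVec d r 0) ≤ B₁)
    (hB0 : ∀ r : ℕ, 3 ≤ r → r ≤ d → srwW d (n + 1) j₀ (classVec d r 0) ≤ B₀)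
    (x : Fin d → ℤ) (hx : ∀ i, vecOfParts d [1, 1, 1] i ≤ |x i|) :
    srwT d n l x ≤ Real.sqrt (srwI d n (2 * m₁) 0) * Real.sqrt B₁ +
      2 / d * (Real.sqrt (srwI d (n + 1) (2 * m₀) 0) * Real.sqrt B₀) := by
  have h1 := srwK_le_on_cone_one_one_one hn (by omega) hd3 m₁ j₁ B₁ hB1 x hx
  have h0 := srwK_le_on_cone_one_one_one (by omega) hd hd3 m₀ j₀ B₀ hB0 x hx
  rw [hl1] at h1
  rw [hl0] at h0
  exact srwT_le_of_srwK_le_two hd l x h1 h0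

end Literature.Probability.FitznerVanDerHofstad2017
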